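import Summits.QuantumFields.YangMills.Theorems.BalabanLadderNTSkewResponseTilt
import Summits.QuantumFields.YangMills.Theorems.LangevinControlUVOSLegsFromFemtoAndGapStubLowerCube
import Summits.QuantumFields.YangMills.Theses.BalabanLadder
import HarnessLib

/-!
# Crux `NT` (stmt-QuantumFields-19353): skew response, II — `Q3 = d/dt|₀ Q2` under a local modulation of the
# coupling; the SIGNED clause (ii), its two-point response form, the squeezed factorisation; `NT` BY NAME

Helper file (`--supports stmt-QuantumFields-19353`) of the fleet lead prover of crux `NT` (unit `ym-spine-19353-p1`,
g5).  It lands §§2–4 of the crux idea `Cruxes/NT/Ideas/skewness-from-asymptotic-freedom.md` (ym-cruxidea-19353-2,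
generations 5–6; HOME sketch `SkewResponse.lean` rev 2, farm-checked there) as tree theorems, with the tilted family
written in Mathlib vocabulary (`MeasureTheory.Measure.tilted`, file I `…NTSkewResponseTilt.lean`) and every target
of the card stated with its definitions UNFOLDED (no new `def`):

* `hasDerivAt_tiltedQ2_at` / **`hasDerivAt_tiltedQ2`** — along the family of Wilson measures on the odd torus
  `2L+1` tilted by `t · F_h`, `F_h = Σ_{z ∈ box} h(s z) · dens_z` (a smooth LOCAL MODULATION OF THE COUPLING near
  `supp h`), the smeared truncated two-point function of `f, g` has derivative the smeared third cumulant in the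
  tilted state; at `t = 0`: **`Q3(f, g, h) = d/dt|₀ Q2^{(t·h)}(f, g)`** (`tiltedQ2_zero`: the value at `0` is `Q2`).
  Exact, every `β`, every torus, every spacing.  Clause (ii) of `LowerBounds` is thus the statement that clause (i)'s
  object RESPONDS at first order to weakening the bare coupling in a disjoint region (free Maxwell does not: the
  tree's duality zero `treeLevelSkewness_vanishes`; the card: Yang–Mills does because the coupling runs, sign `b₀ > 0`).
* `lowerBoundsSnd_of_signed`, `lowerBounds_of_fst_of_signed` — the SIGN-DEFINITE floor `Q3 ≤ −ε` (the card's
  `SignedSkewness`, `σ = −1` in the tree's convention `dens = Σ Re tr U_p`) gives clause (ii) verbatim, and with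
  clause (i) `LowerBounds`;
* `signed_of_modulatedResponse` — the card's two-point TRANSFER `ModulatedResponseFloor ⇒ SignedSkewness`
  (`Q2^{(t·h)} − Q2 ≤ −ε t` on `(0, t₀]` ⇒ `Q3 ≤ −ε`; identity + one-sided slope lemma);
* `signed_of_squeezedFactorisation` — the card's §4: `|Q3 + D| ≤ δ D` (two-body fusion with remainder, `δ < 1`) and a
  dressed two-point floor `D ≥ ε` give `Q3 ≤ −(1−δ)ε`, `D` = the truncated two-point sum dressed by the positive OPE
  weight `W_h(x) = Σ_z h(s z) κ'/‖x−z‖⁴`;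
* `nt_of_signedPackage` — `BalabanLadder.NT` BY NAME from clause (i) ∧ the signed clause (ii), per compact simple `G`.

Consumes audit (LINE №57 discipline): the non-negativity of `f, g, h` and `0 < κ'`, `0 ≤ δ` carried by the card's
`SignedSkewness` / `ModulatedResponseFloor` / `SqueezedFactorisation` are IDLE for these implications and are dropped
here (they matter for the card's PREDICTION of the sign, not for the transfers).  What this file is NOT: no claim
about the one-loop law `OneLoopSkewnessLaw` (the engine's (R3) target with sign and shape supplied by the card), nor
about clause (i).

Refs: card `Cruxes/NT/Ideas/skewness-from-asymptotic-freedom.md` §Mechanism 1–5, §4; route file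
`Theses/BalabanLadder.lean` (decl `NT`); Defs `Theorems/LangevinControlUVOSLegsFromFemtoAndGapDefs.lean` (`Q2`, `Q3`,
`torusK3`, `torusE`, `dens`, `LowerBounds`).
-/

set_option autoImplicit false

noncomputable section

open MeasureTheory ProbabilityTheory Filter Topology

namespace Summit.QuantumFields.YangMills.Cruxes.NT.SkewResponse

/-! ## The torus: `Q3 = d/dt|₀ Q2` under a local modulation of the coupling -/

open scoped SchwartzMap
open Literature.MathematicalPhysics.QuantumFieldTheory Literature.MathematicalPhysics.QuantumLattice
open Literature.Probability.LatticeModels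
open Summit.QuantumFields.YangMills.Cruxes.OSLegsFromFemtoAndGap.DlrCollarTransfer
open Summit.QuantumFields.YangMills.Cruxes.OSLegsFromFemtoAndGap.DlrCollarTransfer.StubLower
  (exists_abs_dens_le)

section Torus

variable (G : Type) [Group G] [TopologicalSpace G] [IsTopologicalGroup G] [CompactSpace G]
  [MeasurableSpace G] [BorelSpace G] (r : LatticeRep G)

/-- The action density at a site, read on the periodic lift of a torus configuration, is measurable. [folklore] -/
theorem measurable_dens_torusLift (L : ℕ) (x : Fin 4 → ℤ) :
    Measurable fun U : GaugeConfig 4 (2 * L + 1) G => dens G r x (torusLift (2 * L + 1) U) := by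
  haveI := r.secondCountableTopology
  exact ((continuous_dens r x).comp (continuous_torusLift _)).measurable

/-- The smeared action density `F_h = Σ_{z ∈ box} h(s z) · dens_z` (the SOURCE of the modulation: tilting Wilson's
weight by `t · F_h` changes the coupling of the plaquettes near `supp h` by `t · h`), read on the lift, is
measurable. [folklore] -/
theorem measurable_smearedDens_torusLift (L : ℕ) (s : ℝ) (h : 𝓢(EuclideanSpace ℝ (Fin 4), ℝ)) :
    Measurable fun U : GaugeConfig 4 (2 * L + 1) G =>
      ∑ z ∈ box 4 L, h (s • siteToE z) * dens G r z (torusLift (2 * L + 1) U) :=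
  Finset.measurable_sum _ fun z _ => (measurable_dens_torusLift G r L z).const_mul _

/-- Uniform bound for the smeared action density from a uniform bound on the density. [folklore] -/
theorem abs_smearedDens_le (L : ℕ) (s : ℝ) (h : 𝓢(EuclideanSpace ℝ (Fin 4), ℝ)) {C : ℝ}
    (hC : ∀ (x : Fin 4 → ℤ) (U : LGConfig 4 G), |dens G r x U| ≤ C) (V : LGConfig 4 G) :
    |∑ z ∈ box 4 L, h (s • siteToE z) * dens G r z V| ≤ ∑ z ∈ box 4 L, |h (s • siteToE z)| * C := by
  refine (Finset.abs_sum_le_sum_abs _ _).trans (Finset.sum_le_sum fun z _ => ?_)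
  rw [abs_mul]
  exact mul_le_mul_of_nonneg_left (hC z V) (abs_nonneg _)

/-- **`d/dt Q2ₜ = Q3ₜ` at every `t₀`.**  Along the family of Wilson measures on the torus of side `2L+1` tilted by
`t · F_h` (`F_h = Σ_z h(s z) dens_z`, a smooth local modulation of the coupling), the smeared truncated two-point
function of `f, g` has derivative the smeared third cumulant `Σ_{x,y,z} f g h · κ₃,ₜ(dens_x, dens_y, dens_z)` computed in
the tilted state (exact; every `β`, every torus, every spacing `s`, every `t₀`). [folklore] -/
theorem hasDerivAt_tiltedQ2_at (β : ℝ) (L : ℕ) (s : ℝ) (h f g : 𝓢(EuclideanSpace ℝ (Fin 4), ℝ)) (t₀ : ℝ) :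
    HasDerivAt
      (fun t => ∑ x ∈ box 4 L, ∑ y ∈ box 4 L, f (s • siteToE x) * g (s • siteToE y) *
        ((∫ U, dens G r x (torusLift (2 * L + 1) U) * dens G r y (torusLift (2 * L + 1) U)
            ∂(wilsonMeasure (d := 4) (L := 2 * L + 1) r.ρ β).tilted fun U =>
              t * ∑ z ∈ box 4 L, h (s • siteToE z) * dens G r z (torusLift (2 * L + 1) U)) -
          (∫ U, dens G r x (torusLift (2 * L + 1) U)
            ∂(wilsonMeasure (d := 4) (L := 2 * L + 1) r.ρ β).tilted fun U =>
              t * ∑ z ∈ box 4 L, h (s • siteToE z) * dens G r z (torusLift (2 * L + 1) U)) *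
          (∫ U, dens G r y (torusLift (2 * L + 1) U)
            ∂(wilsonMeasure (d := 4) (L := 2 * L + 1) r.ρ β).tilted fun U =>
              t * ∑ z ∈ box 4 L, h (s • siteToE z) * dens G r z (torusLift (2 * L + 1) U))))
      (∑ x ∈ box 4 L, ∑ y ∈ box 4 L, f (s • siteToE x) * g (s • siteToE y) *
        ∑ z ∈ box 4 L, h (s • siteToE z) *
          ((∫ U, dens G r x (torusLift (2 * L + 1) U) * dens G r y (torusLift (2 * L + 1) U) *
                dens G r z (torusLift (2 * L + 1) U)
              ∂(wilsonMeasure (d := 4) (L := 2 * L + 1) r.ρ β).tilted fun U =>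
                t₀ * ∑ z ∈ box 4 L, h (s • siteToE z) * dens G r z (torusLift (2 * L + 1) U))
            - (∫ U, dens G r x (torusLift (2 * L + 1) U)
                ∂(wilsonMeasure (d := 4) (L := 2 * L + 1) r.ρ β).tilted fun U =>
                  t₀ * ∑ z ∈ box 4 L, h (s • siteToE z) * dens G r z (torusLift (2 * L + 1) U)) *
              (∫ U, dens G r y (torusLift (2 * L + 1) U) * dens G r z (torusLift (2 * L + 1) U)
                ∂(wilsonMeasure (d := 4) (L := 2 * L + 1) r.ρ β).tilted fun U =>
                  t₀ * ∑ z ∈ box 4 L, h (s • siteToE z) * dens G r z (torusLift (2 * L + 1) U))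
            - (∫ U, dens G r y (torusLift (2 * L + 1) U)
                ∂(wilsonMeasure (d := 4) (L := 2 * L + 1) r.ρ β).tilted fun U =>
                  t₀ * ∑ z ∈ box 4 L, h (s • siteToE z) * dens G r z (torusLift (2 * L + 1) U)) *
              (∫ U, dens G r x (torusLift (2 * L + 1) U) * dens G r z (torusLift (2 * L + 1) U)
                ∂(wilsonMeasure (d := 4) (L := 2 * L + 1) r.ρ β).tilted fun U =>
                  t₀ * ∑ z ∈ box 4 L, h (s • siteToE z) * dens G r z (torusLift (2 * L + 1) U))
            - (∫ U, dens G r z (torusLift (2 * L + 1) U)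
                ∂(wilsonMeasure (d := 4) (L := 2 * L + 1) r.ρ β).tilted fun U =>
                  t₀ * ∑ z ∈ box 4 L, h (s • siteToE z) * dens G r z (torusLift (2 * L + 1) U)) *
              (∫ U, dens G r x (torusLift (2 * L + 1) U) * dens G r y (torusLift (2 * L + 1) U)
                ∂(wilsonMeasure (d := 4) (L := 2 * L + 1) r.ρ β).tilted fun U =>
                  t₀ * ∑ z ∈ box 4 L, h (s • siteToE z) * dens G r z (torusLift (2 * L + 1) U))
            + 2 * ((∫ U, dens G r x (torusLift (2 * L + 1) U)
                ∂(wilsonMeasure (d := 4) (L := 2 * L + 1) r.ρ β).tilted fun U =>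
                  t₀ * ∑ z ∈ box 4 L, h (s • siteToE z) * dens G r z (torusLift (2 * L + 1) U)) *
              (∫ U, dens G r y (torusLift (2 * L + 1) U)
                ∂(wilsonMeasure (d := 4) (L := 2 * L + 1) r.ρ β).tilted fun U =>
                  t₀ * ∑ z ∈ box 4 L, h (s • siteToE z) * dens G r z (torusLift (2 * L + 1) U)) *
              (∫ U, dens G r z (torusLift (2 * L + 1) U)
                ∂(wilsonMeasure (d := 4) (L := 2 * L + 1) r.ρ β).tilted fun U =>
                  t₀ * ∑ z ∈ box 4 L, h (s • siteToE z) * dens G r z (torusLift (2 * L + 1) U)))))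
      t₀ := by
  haveI := r.secondCountableTopology
  haveI := isProbabilityMeasure_wilsonMeasure (d := 4) (L := 2 * L + 1) r.ρ r.continuous β
  obtain ⟨C, -, hC⟩ := exists_abs_dens_le G r
  set μ : Measure (GaugeConfig 4 (2 * L + 1) G) := wilsonMeasure (d := 4) (L := 2 * L + 1) r.ρ β with hμ
  have hmeas := measurable_dens_torusLift G r L
  have hbd : ∀ (x : Fin 4 → ℤ) (U : GaugeConfig 4 (2 * L + 1) G), |dens G r x (torusLift (2 * L + 1) U)| ≤ C :=
    fun x U => hC x _
  have hZm := measurable_smearedDens_torusLift G r L s h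
  have hZb : ∀ U : GaugeConfig 4 (2 * L + 1) G,
      |∑ z ∈ box 4 L, h (s • siteToE z) * dens G r z (torusLift (2 * L + 1) U)| ≤
        ∑ z ∈ box 4 L, |h (s • siteToE z)| * C := fun U => abs_smearedDens_le G r L s h hC _
  -- per pair: `hasDerivAt_cov_tilted` + linearity of `κ₃` in the third slot under the tilted (finite) measure
  have hpair : ∀ x y : Fin 4 → ℤ, HasDerivAt
      (fun t => (∫ U, dens G r x (torusLift (2 * L + 1) U) * dens G r y (torusLift (2 * L + 1) U)
            ∂μ.tilted fun U => t * ∑ z ∈ box 4 L, h (s • siteToE z) * dens G r z (torusLift (2 * L + 1) U)) -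
          (∫ U, dens G r x (torusLift (2 * L + 1) U)
            ∂μ.tilted fun U => t * ∑ z ∈ box 4 L, h (s • siteToE z) * dens G r z (torusLift (2 * L + 1) U)) *
          (∫ U, dens G r y (torusLift (2 * L + 1) U)
            ∂μ.tilted fun U => t * ∑ z ∈ box 4 L, h (s • siteToE z) * dens G r z (torusLift (2 * L + 1) U)))
      (∑ z ∈ box 4 L, h (s • siteToE z) *
          ((∫ U, dens G r x (torusLift (2 * L + 1) U) * dens G r y (torusLift (2 * L + 1) U) *
                dens G r z (torusLift (2 * L + 1) U)
              ∂μ.tilted fun U => t₀ * ∑ z ∈ box 4 L, h (s • siteToE z) * dens G r z (torusLift (2 * L + 1) U))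
            - (∫ U, dens G r x (torusLift (2 * L + 1) U)
                ∂μ.tilted fun U => t₀ * ∑ z ∈ box 4 L, h (s • siteToE z) * dens G r z (torusLift (2 * L + 1) U)) *
              (∫ U, dens G r y (torusLift (2 * L + 1) U) * dens G r z (torusLift (2 * L + 1) U)
                ∂μ.tilted fun U => t₀ * ∑ z ∈ box 4 L, h (s • siteToE z) * dens G r z (torusLift (2 * L + 1) U))
            - (∫ U, dens G r y (torusLift (2 * L + 1) U)
                ∂μ.tilted fun U => t₀ * ∑ z ∈ box 4 L, h (s • siteToE z) * dens G r z (torusLift (2 * L + 1) U)) *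
              (∫ U, dens G r x (torusLift (2 * L + 1) U) * dens G r z (torusLift (2 * L + 1) U)
                ∂μ.tilted fun U => t₀ * ∑ z ∈ box 4 L, h (s • siteToE z) * dens G r z (torusLift (2 * L + 1) U))
            - (∫ U, dens G r z (torusLift (2 * L + 1) U)
                ∂μ.tilted fun U => t₀ * ∑ z ∈ box 4 L, h (s • siteToE z) * dens G r z (torusLift (2 * L + 1) U)) *
              (∫ U, dens G r x (torusLift (2 * L + 1) U) * dens G r y (torusLift (2 * L + 1) U)
                ∂μ.tilted fun U => t₀ * ∑ z ∈ box 4 L, h (s • siteToE z) * dens G r z (torusLift (2 * L + 1) U))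
            + 2 * ((∫ U, dens G r x (torusLift (2 * L + 1) U)
                ∂μ.tilted fun U => t₀ * ∑ z ∈ box 4 L, h (s • siteToE z) * dens G r z (torusLift (2 * L + 1) U)) *
              (∫ U, dens G r y (torusLift (2 * L + 1) U)
                ∂μ.tilted fun U => t₀ * ∑ z ∈ box 4 L, h (s • siteToE z) * dens G r z (torusLift (2 * L + 1) U)) *
              (∫ U, dens G r z (torusLift (2 * L + 1) U)
                ∂μ.tilted fun U => t₀ * ∑ z ∈ box 4 L, h (s • siteToE z) * dens G r z (torusLift (2 * L + 1) U)))))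
      t₀ := by
    intro x y
    have hd := hasDerivAt_cov_tilted (μ := μ) hZm (hmeas x) (hmeas y) hZb (hbd x) (hbd y) t₀
    refine hd.congr_deriv ?_
    exact k3_sum_third (μ := μ.tilted fun U => t₀ * ∑ z ∈ box 4 L, h (s • siteToE z) *
        dens G r z (torusLift (2 * L + 1) U)) (box 4 L) (fun z => h (s • siteToE z))
      (X := fun U => dens G r x (torusLift (2 * L + 1) U)) (Y := fun U => dens G r y (torusLift (2 * L + 1) U))
      (D := fun z U => dens G r z (torusLift (2 * L + 1) U)) (hmeas x) (hmeas y) hmeas (hbd x) (hbd y) hbd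
  refine HasDerivAt.fun_sum fun x _ => HasDerivAt.fun_sum fun y _ => ?_
  exact (hpair x y).const_mul _

/-- **At `t = 0` the tilted family is Wilson's measure**: the modulated two-point function at `t = 0` is `Q2`.
[folklore] -/
theorem tiltedQ2_zero (β : ℝ) (L : ℕ) (s : ℝ) (h f g : 𝓢(EuclideanSpace ℝ (Fin 4), ℝ)) :
    (∑ x ∈ box 4 L, ∑ y ∈ box 4 L, f (s • siteToE x) * g (s • siteToE y) *
        ((∫ U, dens G r x (torusLift (2 * L + 1) U) * dens G r y (torusLift (2 * L + 1) U)
            ∂(wilsonMeasure (d := 4) (L := 2 * L + 1) r.ρ β).tilted fun U =>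
              (0 : ℝ) * ∑ z ∈ box 4 L, h (s • siteToE z) * dens G r z (torusLift (2 * L + 1) U)) -
          (∫ U, dens G r x (torusLift (2 * L + 1) U)
            ∂(wilsonMeasure (d := 4) (L := 2 * L + 1) r.ρ β).tilted fun U =>
              (0 : ℝ) * ∑ z ∈ box 4 L, h (s • siteToE z) * dens G r z (torusLift (2 * L + 1) U)) *
          (∫ U, dens G r y (torusLift (2 * L + 1) U)
            ∂(wilsonMeasure (d := 4) (L := 2 * L + 1) r.ρ β).tilted fun U =>
              (0 : ℝ) * ∑ z ∈ box 4 L, h (s • siteToE z) * dens G r z (torusLift (2 * L + 1) U)))) =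
      Q2 G r β L s f g := by
  haveI := isProbabilityMeasure_wilsonMeasure (d := 4) (L := 2 * L + 1) r.ρ r.continuous β
  simp only [tilted_zero_mul, Q2, torusE]

/-- **`Q3 = d/dt|₀ Q2^{(t·h)}`** — the smeared truncated three-point function of the action density on the torus is
the first-order response of the smeared truncated two-point function of `f, g` to tilting Wilson's measure by the
smeared density `t · F_h`, i.e. to a smooth local modulation of the coupling near `supp h` (exact; every `β`,
every odd torus, every spacing `s`).  Free Maxwell would not respond (the tree's duality zero
`treeLevelSkewness_vanishes`); the card's thesis is that Yang–Mills responds because the coupling runs. [folklore] -/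
theorem hasDerivAt_tiltedQ2 (β : ℝ) (L : ℕ) (s : ℝ) (h f g : 𝓢(EuclideanSpace ℝ (Fin 4), ℝ)) :
    HasDerivAt
      (fun t => ∑ x ∈ box 4 L, ∑ y ∈ box 4 L, f (s • siteToE x) * g (s • siteToE y) *
        ((∫ U, dens G r x (torusLift (2 * L + 1) U) * dens G r y (torusLift (2 * L + 1) U)
            ∂(wilsonMeasure (d := 4) (L := 2 * L + 1) r.ρ β).tilted fun U =>
              t * ∑ z ∈ box 4 L, h (s • siteToE z) * dens G r z (torusLift (2 * L + 1) U)) -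
          (∫ U, dens G r x (torusLift (2 * L + 1) U)
            ∂(wilsonMeasure (d := 4) (L := 2 * L + 1) r.ρ β).tilted fun U =>
              t * ∑ z ∈ box 4 L, h (s • siteToE z) * dens G r z (torusLift (2 * L + 1) U)) *
          (∫ U, dens G r y (torusLift (2 * L + 1) U)
            ∂(wilsonMeasure (d := 4) (L := 2 * L + 1) r.ρ β).tilted fun U =>
              t * ∑ z ∈ box 4 L, h (s • siteToE z) * dens G r z (torusLift (2 * L + 1) U))))
      (Q3 G r β L s f g h) 0 := by
  haveI := isProbabilityMeasure_wilsonMeasure (d := 4) (L := 2 * L + 1) r.ρ r.continuous β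
  have hd := hasDerivAt_tiltedQ2_at G r β L s h f g 0
  refine hd.congr_deriv ?_
  simp only [tilted_zero_mul]
  simp only [Q3, torusK3, torusE, Finset.mul_sum]
  exact Finset.sum_congr rfl fun x _ => Finset.sum_congr rfl fun y _ => Finset.sum_congr rfl fun z _ => by ring

/-! ## Transfers: the SIGNED clause (ii), its two-point response form, the squeezed factorisation -/

variable (a : ℝ → ℝ)

/-- A SIGN-DEFINITE three-point floor `Q3(f, g, h) ≤ −ε` (the card's repaired clause (ii), `σ = −1` in the tree's
convention `dens = Σ Re tr U_p`) gives clause (ii) of `LowerBounds` verbatim. [folklore] -/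
theorem lowerBoundsSnd_of_signed
    (hS : ∃ (f g h : 𝓢(EuclideanSpace ℝ (Fin 4), ℝ)) (ε β₅ Λ₅ : ℝ),
      Disjoint (tsupport (f : EuclideanSpace ℝ (Fin 4) → ℝ)) (tsupport (g : EuclideanSpace ℝ (Fin 4) → ℝ)) ∧
      Disjoint (tsupport (g : EuclideanSpace ℝ (Fin 4) → ℝ)) (tsupport (h : EuclideanSpace ℝ (Fin 4) → ℝ)) ∧
      Disjoint (tsupport (f : EuclideanSpace ℝ (Fin 4) → ℝ)) (tsupport (h : EuclideanSpace ℝ (Fin 4) → ℝ)) ∧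
      0 < ε ∧ ∀ β : ℝ, β₅ ≤ β → ∀ L : ℕ, Λ₅ ≤ a β * L → Q3 G r β L (a β) f g h ≤ -ε) :
    ∃ (f g h : 𝓢(EuclideanSpace ℝ (Fin 4), ℝ)) (ε β₅ Λ₅ : ℝ),
      Disjoint (tsupport (f : EuclideanSpace ℝ (Fin 4) → ℝ)) (tsupport (g : EuclideanSpace ℝ (Fin 4) → ℝ)) ∧
      Disjoint (tsupport (g : EuclideanSpace ℝ (Fin 4) → ℝ)) (tsupport (h : EuclideanSpace ℝ (Fin 4) → ℝ)) ∧
      Disjoint (tsupport (f : EuclideanSpace ℝ (Fin 4) → ℝ)) (tsupport (h : EuclideanSpace ℝ (Fin 4) → ℝ)) ∧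
      0 < ε ∧ ∀ β : ℝ, β₅ ≤ β → ∀ L : ℕ, Λ₅ ≤ a β * L → ε ≤ |Q3 G r β L (a β) f g h| := by
  obtain ⟨f, g, h, ε, β₅, Λ₅, hfg, hgh, hfh, hε, hfl⟩ := hS
  refine ⟨f, g, h, ε, β₅, Λ₅, hfg, hgh, hfh, hε, fun β hβ L hL => ?_⟩
  have := hfl β hβ L hL
  rw [le_abs]
  right
  linarith

/-- With clause (i) supplied by anyone, the signed clause (ii) gives `LowerBounds G r a`. [folklore] -/
theorem lowerBounds_of_fst_of_signed
    (h₁ : ∃ (v : 𝓢(EuclideanSpace ℝ (Fin 4), ℝ)) (ε β₅ Λ₅ : ℝ),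
      tsupport (v : EuclideanSpace ℝ (Fin 4) → ℝ) ⊆ {y | 0 < y 0} ∧ 0 < ε ∧
      ∀ β : ℝ, β₅ ≤ β → ∀ L : ℕ, Λ₅ ≤ a β * L → ε ≤ Q2 G r β L (a β) (thetaTest 4 v) v)
    (h₂ : ∃ (f g h : 𝓢(EuclideanSpace ℝ (Fin 4), ℝ)) (ε β₅ Λ₅ : ℝ),
      Disjoint (tsupport (f : EuclideanSpace ℝ (Fin 4) → ℝ)) (tsupport (g : EuclideanSpace ℝ (Fin 4) → ℝ)) ∧
      Disjoint (tsupport (g : EuclideanSpace ℝ (Fin 4) → ℝ)) (tsupport (h : EuclideanSpace ℝ (Fin 4) → ℝ)) ∧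
      Disjoint (tsupport (f : EuclideanSpace ℝ (Fin 4) → ℝ)) (tsupport (h : EuclideanSpace ℝ (Fin 4) → ℝ)) ∧
      0 < ε ∧ ∀ β : ℝ, β₅ ≤ β → ∀ L : ℕ, Λ₅ ≤ a β * L → Q3 G r β L (a β) f g h ≤ -ε) :
    LowerBounds G r a :=
  ⟨h₁, lowerBoundsSnd_of_signed G r a h₂⟩

/-- **Transfer from TWO-POINT currency (the card's `ModulatedResponseFloor`).**  If, under the weak local modulation
`t · F_h` (`t ∈ (0, t₀]`) of the coupling near `supp h`, the smeared truncated two-point function of `f, g` DROPS at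
a linear rate — `Q2^{(t·h)}(f, g) − Q2(f, g) ≤ −ε t` on every large torus at every large coupling — then the signed
three-point floor `Q3(f, g, h) ≤ −ε` holds there (exact identity `hasDerivAt_tiltedQ2` + one-sided slope lemma).
[folklore] -/
theorem signed_of_modulatedResponse
    (hM : ∃ (f g h : 𝓢(EuclideanSpace ℝ (Fin 4), ℝ)) (ε t₀ β₅ Λ₅ : ℝ),
      Disjoint (tsupport (f : EuclideanSpace ℝ (Fin 4) → ℝ)) (tsupport (g : EuclideanSpace ℝ (Fin 4) → ℝ)) ∧
      Disjoint (tsupport (g : EuclideanSpace ℝ (Fin 4) → ℝ)) (tsupport (h : EuclideanSpace ℝ (Fin 4) → ℝ)) ∧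
      Disjoint (tsupport (f : EuclideanSpace ℝ (Fin 4) → ℝ)) (tsupport (h : EuclideanSpace ℝ (Fin 4) → ℝ)) ∧
      0 < ε ∧ 0 < t₀ ∧ ∀ β : ℝ, β₅ ≤ β → ∀ L : ℕ, Λ₅ ≤ a β * L → ∀ t : ℝ, 0 < t → t ≤ t₀ →
        (∑ x ∈ box 4 L, ∑ y ∈ box 4 L, f (a β • siteToE x) * g (a β • siteToE y) *
          ((∫ U, dens G r x (torusLift (2 * L + 1) U) * dens G r y (torusLift (2 * L + 1) U)
              ∂(wilsonMeasure (d := 4) (L := 2 * L + 1) r.ρ β).tilted fun U =>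
                t * ∑ z ∈ box 4 L, h (a β • siteToE z) * dens G r z (torusLift (2 * L + 1) U)) -
            (∫ U, dens G r x (torusLift (2 * L + 1) U)
              ∂(wilsonMeasure (d := 4) (L := 2 * L + 1) r.ρ β).tilted fun U =>
                t * ∑ z ∈ box 4 L, h (a β • siteToE z) * dens G r z (torusLift (2 * L + 1) U)) *
            (∫ U, dens G r y (torusLift (2 * L + 1) U)
              ∂(wilsonMeasure (d := 4) (L := 2 * L + 1) r.ρ β).tilted fun U =>
                t * ∑ z ∈ box 4 L, h (a β • siteToE z) * dens G r z (torusLift (2 * L + 1) U)))) -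
          Q2 G r β L (a β) f g ≤ -ε * t) :
    ∃ (f g h : 𝓢(EuclideanSpace ℝ (Fin 4), ℝ)) (ε β₅ Λ₅ : ℝ),
      Disjoint (tsupport (f : EuclideanSpace ℝ (Fin 4) → ℝ)) (tsupport (g : EuclideanSpace ℝ (Fin 4) → ℝ)) ∧
      Disjoint (tsupport (g : EuclideanSpace ℝ (Fin 4) → ℝ)) (tsupport (h : EuclideanSpace ℝ (Fin 4) → ℝ)) ∧
      Disjoint (tsupport (f : EuclideanSpace ℝ (Fin 4) → ℝ)) (tsupport (h : EuclideanSpace ℝ (Fin 4) → ℝ)) ∧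
      0 < ε ∧ ∀ β : ℝ, β₅ ≤ β → ∀ L : ℕ, Λ₅ ≤ a β * L → Q3 G r β L (a β) f g h ≤ -ε := by
  obtain ⟨f, g, h, ε, t₀, β₅, Λ₅, hfg, hgh, hfh, hε, ht₀, hfl⟩ := hM
  refine ⟨f, g, h, ε, β₅, Λ₅, hfg, hgh, hfh, hε, fun β hβ L hL => ?_⟩
  have hD := hasDerivAt_tiltedQ2 G r β L (a β) h f g
  have h0 := tiltedQ2_zero G r β L (a β) h f g
  have := deriv_le_of_increment_le (c := -ε) ht₀ hD (fun t ht htt => by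
    have hb := hfl β hβ L hL t ht htt
    rw [← h0] at hb
    simpa only using hb)
  linarith

/-- **Squeezed factorisation + a dressed two-point floor ⇒ the signed clause (ii)** (the card's §4, generation 6).
In the squeezed geometry the engine's one-loop content is the two-body statement
`|Q3(f,g,h) + D(f,g;h,κ')| ≤ δ · D(f,g;h,κ')` (`δ < 1`), where
`D = Σ_{x,y} f(s x) · W_h(x) · g(s y) · Cov_T(dens_x, dens_y)` is the truncated two-point sum dressed by the positive OPE
weight `W_h(x) = Σ_z h(s z) · κ'/‖x − z‖⁴`; together with a floor `D ≥ ε` of clause (i)'s class for the dressed pair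
it gives `Q3(f,g,h) ≤ −(1 − δ) ε` (`0 < κ'` and `0 ≤ δ` of the card's `SqueezedFactorisation` are idle here and
dropped). [folklore] -/
theorem signed_of_squeezedFactorisation {κ' δ : ℝ} (f g h : 𝓢(EuclideanSpace ℝ (Fin 4), ℝ))
    (hfg : Disjoint (tsupport (f : EuclideanSpace ℝ (Fin 4) → ℝ)) (tsupport (g : EuclideanSpace ℝ (Fin 4) → ℝ)))
    (hgh : Disjoint (tsupport (g : EuclideanSpace ℝ (Fin 4) → ℝ)) (tsupport (h : EuclideanSpace ℝ (Fin 4) → ℝ)))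
    (hfh : Disjoint (tsupport (f : EuclideanSpace ℝ (Fin 4) → ℝ)) (tsupport (h : EuclideanSpace ℝ (Fin 4) → ℝ)))
    (hδ1 : δ < 1)
    (hSF : ∃ β₅ Λ₅ : ℝ, ∀ β : ℝ, β₅ ≤ β → ∀ L : ℕ, Λ₅ ≤ a β * L →
      |Q3 G r β L (a β) f g h +
          ∑ x ∈ box 4 L, ∑ y ∈ box 4 L, f (a β • siteToE x) *
            (∑ z ∈ box 4 L, h (a β • siteToE z) * (κ' / ‖siteToE (x - z)‖ ^ 4)) * g (a β • siteToE y) *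
            (torusE G r β L (fun U => dens G r x U * dens G r y U) -
              torusE G r β L (dens G r x) * torusE G r β L (dens G r y))| ≤
        δ * ∑ x ∈ box 4 L, ∑ y ∈ box 4 L, f (a β • siteToE x) *
            (∑ z ∈ box 4 L, h (a β • siteToE z) * (κ' / ‖siteToE (x - z)‖ ^ 4)) * g (a β • siteToE y) *
            (torusE G r β L (fun U => dens G r x U * dens G r y U) -
              torusE G r β L (dens G r x) * torusE G r β L (dens G r y)))
    (hF : ∃ ε β₅ Λ₅ : ℝ, 0 < ε ∧ ∀ β : ℝ, β₅ ≤ β → ∀ L : ℕ, Λ₅ ≤ a β * L →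
      ε ≤ ∑ x ∈ box 4 L, ∑ y ∈ box 4 L, f (a β • siteToE x) *
            (∑ z ∈ box 4 L, h (a β • siteToE z) * (κ' / ‖siteToE (x - z)‖ ^ 4)) * g (a β • siteToE y) *
            (torusE G r β L (fun U => dens G r x U * dens G r y U) -
              torusE G r β L (dens G r x) * torusE G r β L (dens G r y))) :
    ∃ (f g h : 𝓢(EuclideanSpace ℝ (Fin 4), ℝ)) (ε β₅ Λ₅ : ℝ),
      Disjoint (tsupport (f : EuclideanSpace ℝ (Fin 4) → ℝ)) (tsupport (g : EuclideanSpace ℝ (Fin 4) → ℝ)) ∧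
      Disjoint (tsupport (g : EuclideanSpace ℝ (Fin 4) → ℝ)) (tsupport (h : EuclideanSpace ℝ (Fin 4) → ℝ)) ∧
      Disjoint (tsupport (f : EuclideanSpace ℝ (Fin 4) → ℝ)) (tsupport (h : EuclideanSpace ℝ (Fin 4) → ℝ)) ∧
      0 < ε ∧ ∀ β : ℝ, β₅ ≤ β → ∀ L : ℕ, Λ₅ ≤ a β * L → Q3 G r β L (a β) f g h ≤ -ε := by
  obtain ⟨β₅, Λ₅, hfac⟩ := hSF
  obtain ⟨ε, β₅', Λ₅', hε, hfl⟩ := hF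
  refine ⟨f, g, h, (1 - δ) * ε, max β₅ β₅', max Λ₅ Λ₅', hfg, hgh, hfh, mul_pos (by linarith) hε,
    fun β hβ L hL => ?_⟩
  have hb := hfac β (le_trans (le_max_left _ _) hβ) L (le_trans (le_max_left _ _) hL)
  have hD := hfl β (le_trans (le_max_right _ _) hβ) L (le_trans (le_max_right _ _) hL)
  rw [abs_le] at hb
  nlinarith [hb.2, hD, hδ1, hε]

end Torus

/-! ## The crux `BalabanLadder.NT` BY NAME from clause (i) and the signed clause (ii) -/

/-- **`BalabanLadder.NT` BY NAME from the signed package**: for every compact simple `G` (Borel σ-algebra) one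
`(r, a)` (`0 < a`, `a → 0`) with clause (i) of `LowerBounds` and the SIGN-DEFINITE three-point floor
`Q3(f, g, h) ≤ −ε` (pairwise-disjoint supports) on every large torus at every large coupling. [folklore] -/
theorem nt_of_signedPackage
    (hP : ∀ (G : Type) [Group G] [TopologicalSpace G] [IsTopologicalGroup G] [CompactSpace G],
      IsCompactSimpleLieGroup G → letI : MeasurableSpace G := borel G; haveI : BorelSpace G := ⟨rfl⟩;
      ∃ (r : LatticeRep G) (a : ℝ → ℝ), (∀ β, 0 < a β) ∧ Tendsto a atTop (𝓝 0) ∧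
        (∃ (v : 𝓢(EuclideanSpace ℝ (Fin 4), ℝ)) (ε β₅ Λ₅ : ℝ),
          tsupport (v : EuclideanSpace ℝ (Fin 4) → ℝ) ⊆ {y | 0 < y 0} ∧ 0 < ε ∧
          ∀ β : ℝ, β₅ ≤ β → ∀ L : ℕ, Λ₅ ≤ a β * L → ε ≤ Q2 G r β L (a β) (thetaTest 4 v) v) ∧
        (∃ (f g h : 𝓢(EuclideanSpace ℝ (Fin 4), ℝ)) (ε β₅ Λ₅ : ℝ),
          Disjoint (tsupport (f : EuclideanSpace ℝ (Fin 4) → ℝ)) (tsupport (g : EuclideanSpace ℝ (Fin 4) → ℝ)) ∧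
          Disjoint (tsupport (g : EuclideanSpace ℝ (Fin 4) → ℝ)) (tsupport (h : EuclideanSpace ℝ (Fin 4) → ℝ)) ∧
          Disjoint (tsupport (f : EuclideanSpace ℝ (Fin 4) → ℝ)) (tsupport (h : EuclideanSpace ℝ (Fin 4) → ℝ)) ∧
          0 < ε ∧ ∀ β : ℝ, β₅ ≤ β → ∀ L : ℕ, Λ₅ ≤ a β * L → Q3 G r β L (a β) f g h ≤ -ε)) :
    Summit.QuantumFields.YangMills.Theses.BalabanLadder.NT := by
  intro G _ _ _ _ hG
  letI : MeasurableSpace G := borel G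
  haveI : BorelSpace G := ⟨rfl⟩
  obtain ⟨r, a, ha₀, ha, h₁, h₂⟩ := hP G hG
  exact ⟨r, a, ha₀, ha, lowerBounds_of_fst_of_signed G r a h₁ h₂⟩

end Summit.QuantumFields.YangMills.Cruxes.NT.SkewResponse

end
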